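import Literature.MathematicalPhysics.QuantumFieldTheory.Balaban1983to89.B8Prop7TowerAxialRecord
import Literature.MathematicalPhysics.QuantumFieldTheory.Balaban1983to89.B8Prop7TowerAxialCollarP
import Literature.MathematicalPhysics.QuantumFieldTheory.Balaban1983to89.B8Prop7TowerAxialIneq145P
import Literature.MathematicalPhysics.QuantumFieldTheory.Balaban1983to89.B8Prop7TowerAxialAdmissible
import Literature.MathematicalPhysics.QuantumFieldTheory.Balaban1983to89.Node00.CarriersB8SubBP

/-!
# `Balaban1983to89.B8Prop7TowerAxialRecordP` — [Balaban1985RegularSpaces] Proposition 7 (Sect. G p. 100, (1.144)–(1.145)) FOR PRINT'S TOWER-WISE AXIAL MAP READ AT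
# NODE 00's P-PIN `famB8OfRecordSubBP` (`Node00/CarriersB8SubBP`, p592605): the record-keyed face of this seat's collar lemma `B8Prop7TowerAxialCollarP` (p598716) — n05-c g6's
# `B8Prop7TowerAxialRecord.prop7RepairedC_famB8OfRecordSubBH` pattern on the P-carrier, (1.145) in print's one-end-point class, MEMBER-INDEXED modulo the per-member (1.4)
# collar law, and on the (inhabited) collar sub-family of `IdxB8SubB θ`

statement-level skeleton of published theorems with citation tags; proofs where landed; nothing here is a claim about the Yang–Mills mass gap

T. Bałaban, *Spaces of regular gauge field configurations on a lattice and gauge fixing conditions*, Commun. Math. Phys. **99** (1985) 75–102 `[Balaban1985RegularSpaces]`: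
Prop. 7 (1.144)–(1.145) p. 100, (1.29) p. 81, (1.35) p. 82, (1.4)–(1.5) p. 77, p. 77 (bond convention).  PDF held: `paper:balaban1985-cmp99-regular-spaces-gauge-fixing`.

WHY (cell `pub-ymgap`, width seat `pub-ymgap-dag-n05-w1` g0, 2026-08-28; count-neutral).  dag-n05-d's P-slot knits (`Thm/…N05SubBPKnitGammaPrime`, D9b ∕ D9d) display the Prop-7 conjunct
`p7 : B8SectGH.Prop7PrintedR (famB8OfRecordSubBP θ λ.β λ.len ·) (λ.toAxial ·.1)`; the honest object behind it, for print's (1.29)-restricted tower-wise axial map in the type of the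
residual field (n05-c g6's `toAxialTowerResid`), is `B8Ineq145.Prop7RepairedC` — here supplied ON THE P-PIN's family over the four-law sub-index `IdxB8SubB θ` from this seat's
`prop7RepairedC_zdGF3P_toAxialTower` — MEMBER-INDEXED: for ANY index map `e : J → IdxB8SubB θ` whose members obey the (1.4) collar law (laws `trunc_lt` ∕ `trunc_top` from the
index, as in n05-c's face), and, as a corollary, on the COLLAR SUB-FAMILY `{j : IdxB8SubB θ ∕∕ collar j}` — the SAME subtype as n05-w2 g2's one-level-up edition
`B8Prop7TowerAxialIneq145P.prop7RepairedC_famB8OfRecordSubBP_oneUp` (p598518; constant `26384(θ.D+1)θ.L·530θ.D`), so the two editions are interchangeable by name; the sub-family is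
INHABITED (n05-w2's `exists_idxB8SubB_collar_topCube`: print's nested tower at every depth, read here as `Nonempty`).  NOT keyed on a collar hypothesis quantified over ALL of
`IdxB8SubB θ`: the typed index laws do not imply (1.4) (n05-w2 g2 LOCATED-COLLAR-FORALL, bus l.27734: lawful members with equal consecutive domains, collar width `ρ = 0`, violate it),
so such an edition would be vacuous (rule №189).  Three theorems; by name; nothing restated.

HONEST SCOPE: by-name instances; constant `530·θ.D·θ.L²` and threshold `cst∕L²` are the tree's crude witnesses (print: `2α₂`); the collar law is a displayed PER-MEMBER HYPOTHESIS ∕ the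
sub-family's predicate — (1.4) is print's, NOT a law of the typed index (whether it should become one is the planners' question); whether the
knit's literal `Prop7PrintedR` conjunct is booked from `Prop7RepairedC` is the planners' ∕ `B8Ineq145`'s species question (n05-c g6 note), not claimed; count-neutral; N05 NOT
discharged; no count claim; one finite `𝕋⁴` programme at fixed `ε`, Bałaban AS PRINTED; the Yang–Mills mass gap (Clay) is NOT proved by any of this — R4 closes the conditional
finite-`𝕋⁴` rung `BalabanLadder.UV` only; nothing continuum ∕ ℝ⁴ ∕ OS.  No `sorry`, no `def`, no `instance`, no `notation`.  Unit `pub-ymgap-dag-n05-w1` (g0), 2026-08-28.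

[cite: Balaban1985RegularSpaces, Prop. 7 (1.144)–(1.145) p.100, (1.29) p.81, (1.35) p.82, (1.3)–(1.5) p.77, (1.131) p.99]
-/

noncomputable section

namespace Literature.MathematicalPhysics.QuantumFieldTheory.Balaban1983to89.B8Prop7TowerAxialRecordP

open Node00 (IdxB8 famB8OfRecord ResidB8 famB8OfRecordSubBP Stage1Params.two_le_L)
open B8IdxB8LawsB (IdxB8LawsB IdxB8SubB famB8OfRecordSubB)
open B7Prop1Local (InBox loK bondHiK)
open B8LeafModelZd3P (EndBlockIn)
open B8Prop7TowerAxialRecord (toAxialTowerResid)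
open B8Prop7TowerAxialCollarP (prop7RepairedC_zdGF3P_toAxialTower)
open B8Prop7TowerAxialIneq145P (exists_idxB8SubB_collar_topCube)
open B8Prop7TowerAxialAdmissible (collar_of_domainSeq' exists_idxB8SubB_domainSeq_topCube)

variable {θ : Node00.Stage3Params} (β : ℝ) (len : B7Prop1Explicit.Site θ.D → ℝ)

/-- ★ **PROPOSITION 7 (repaired constant `530·θ.D·θ.L²`, (1.145) in print's ONE-END-POINT class) FOR PRINT'S TOWER-WISE MAP AT THE [B8″P] GROUP OF RECORD,
MEMBER-INDEXED** — for ANY index map `e : J → IdxB8SubB θ` into n05-c's four-law sub-index (`Ω₀ = ℤᵈ`, laws №8) whose members obey print's (1.4) collar law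
(«the two-block box of a level-`l` bond with an end block in `Ω_l` lies in `Ω_{l−1}`», displayed PER MEMBER), at every `θ` with `θ.D ≥ 2`: this seat's
`B8Prop7TowerAxialCollarP.prop7RepairedC_zdGF3P_toAxialTower` at `(·.1.1) ∘ e` (`famB8OfRecordSubBP θ β len j = zdGF3HP θ.𝔸 θ.L β len j.1.1`, whose Prop-7 letters are
`zdGF3P`'s by `rfl`).  `J` is the consumer's: a knit keyed on collar-law members instantiates it; the collar sub-family is the next theorem.
[cite: Balaban1985RegularSpaces, Prop. 7 (1.144)–(1.145) p.100 (constant: audit G-adv8-16 ∕ `B8Ineq145`), (1.4) p.77, p.77] -/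
theorem prop7RepairedC_famB8OfRecordSubBP_toAxialTower (hD : 2 ≤ θ.D) {J : Type} (e : J → IdxB8SubB θ)
    (hcollar : ∀ a, ∀ l, l ≤ (e a).1.1.k → ∀ (z : B7Prop1Explicit.Site θ.D) (μ : Fin θ.D), EndBlockIn θ.L ((e a).1.1.Ω l) l z μ →
      ∀ x, InBox (loK θ.L l z) (bondHiK θ.L l z μ) x → x ∈ (e a).1.1.Ω (l - 1)) :
    B8Ineq145.Prop7RepairedC (530 * (θ.D : ℝ) * (θ.L : ℝ) ^ 2) (fun a : J => famB8OfRecordSubBP θ β len (e a))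
      (fun a => toAxialTowerResid θ β len (e a).1) :=
  prop7RepairedC_zdGF3P_toAxialTower θ.𝔸 θ.L β len hD θ.two_le_L (fun a : J => (e a).1.1) (fun a => (e a).1.2)
    (fun a => (e a).2.toIdxB8Laws.trunc_lt) (fun a => (e a).2.toIdxB8Laws.trunc_top) hcollar

/-- ★ **… ON THE COLLAR SUB-FAMILY** `{j : IdxB8SubB θ ∕∕ (1.4) at j}` — the SAME subtype as n05-w2 g2's `B8Prop7TowerAxialIneq145P.prop7RepairedC_famB8OfRecordSubBP_oneUp`
(constant there `26384(θ.D+1)θ.L·530θ.D`; here `530·θ.D·θ.L²`): the previous theorem at `e := Subtype.val`.  Inhabited: next theorem.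
[cite: Balaban1985RegularSpaces, Prop. 7 (1.144)–(1.145) p.100, (1.4) p.77] -/
theorem prop7RepairedC_famB8OfRecordSubBP_toAxialTower_collar (hD : 2 ≤ θ.D) :
    B8Ineq145.Prop7RepairedC (530 * (θ.D : ℝ) * (θ.L : ℝ) ^ 2)
      (fun j : {j : IdxB8SubB θ // ∀ l, l ≤ j.1.1.k → ∀ (z : B7Prop1Explicit.Site θ.D) (μ : Fin θ.D), EndBlockIn θ.L (j.1.1.Ω l) l z μ →
          ∀ x, InBox (loK θ.L l z) (bondHiK θ.L l z μ) x → x ∈ j.1.1.Ω (l - 1)} =>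
        famB8OfRecordSubBP θ β len j.1)
      (fun j => toAxialTowerResid θ β len j.1.1) :=
  prop7RepairedC_famB8OfRecordSubBP_toAxialTower β len hD
    (fun j : {j : IdxB8SubB θ // ∀ l, l ≤ j.1.1.k → ∀ (z : B7Prop1Explicit.Site θ.D) (μ : Fin θ.D), EndBlockIn θ.L (j.1.1.Ω l) l z μ →
        ∀ x, InBox (loK θ.L l z) (bondHiK θ.L l z μ) x → x ∈ j.1.1.Ω (l - 1)} => j.1)
    (fun j => j.2)

/-- **A6 — THE COLLAR SUB-FAMILY IS INHABITED AT EVERY `θ`** (so the previous theorem is not vacuous): n05-w2 g2's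
`B8Prop7TowerAxialIneq145P.exists_idxB8SubB_collar_topCube` (print's nested tower `(T, □₁)`, depth `1`, collar width `ρ = θ.L`) read as `Nonempty`; by name.
[cite: Balaban1985RegularSpaces, (1.131) p.99, (1.3)–(1.4) p.77] -/
theorem nonempty_idxB8SubB_collar (θ : Node00.Stage3Params) :
    Nonempty {j : IdxB8SubB θ // ∀ l, l ≤ j.1.1.k → ∀ (z : B7Prop1Explicit.Site θ.D) (μ : Fin θ.D), EndBlockIn θ.L (j.1.1.Ω l) l z μ →
      ∀ x, InBox (loK θ.L l z) (bondHiK θ.L l z μ) x → x ∈ j.1.1.Ω (l - 1)} := by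
  obtain ⟨j, -, -, hj⟩ := exists_idxB8SubB_collar_topCube θ (le_refl 1)
  exact ⟨⟨j, hj⟩⟩

#print axioms prop7RepairedC_famB8OfRecordSubBP_toAxialTower
#print axioms prop7RepairedC_famB8OfRecordSubBP_toAxialTower_collar
#print axioms nonempty_idxB8SubB_collar

/-! ## v1.1 (APPEND, unit `pub-ymgap-dag-n05-w1` g0, 2026-08-28) — the «ADMISSIBLE MEMBERS» editions: the (1.4) collar hypothesis DISCHARGED from print's
(1.3)–(1.4) AS TYPED, `B8ConstraintBonds.DomainSeq θ.L Ω` (n05-w2 g2's `B8Prop7TowerAxialAdmissible.collar_of_domainSeq'`, p601036, by name) -/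

/-- ★ **PROPOSITION 7 (repaired constant `530·θ.D·θ.L²`, print's one-end-point (1.145)) FOR PRINT'S TOWER-WISE MAP AT THE [B8″P] GROUP OF RECORD, MEMBER-INDEXED
OVER ADMISSIBLE MEMBERS** — for ANY index map `e : J → IdxB8SubB θ` whose members' Ω-towers are sequences of domains in print's sense (1.3)–(1.4)
(`B8ConstraintBonds.DomainSeq θ.L (e a).1.1.Ω`, displayed PER MEMBER): `prop7RepairedC_famB8OfRecordSubBP_toAxialTower` with the collar law supplied by
n05-w2 g2's `collar_of_domainSeq'` (`Ω₀ = ℤᵈ` from the index). [cite: Balaban1985RegularSpaces, Prop. 7 (1.144)–(1.145) p.100, (1.3)–(1.4) p.77] -/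
theorem prop7RepairedC_famB8OfRecordSubBP_toAxialTower_admissible (hD : 2 ≤ θ.D) {J : Type} (e : J → IdxB8SubB θ)
    (hadm : ∀ a, B8ConstraintBonds.DomainSeq θ.L (e a).1.1.Ω) :
    B8Ineq145.Prop7RepairedC (530 * (θ.D : ℝ) * (θ.L : ℝ) ^ 2) (fun a : J => famB8OfRecordSubBP θ β len (e a))
      (fun a => toAxialTowerResid θ β len (e a).1) :=
  prop7RepairedC_famB8OfRecordSubBP_toAxialTower β len hD e
    (fun a => collar_of_domainSeq' (le_trans one_le_two θ.two_le_L) (e a).1.1 (e a).1.2 (hadm a))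

/-- ★ **… ON THE ADMISSIBLE SUB-FAMILY** `{j : IdxB8SubB θ ∕∕ DomainSeq θ.L j.1.1.Ω}` — the SAME subtype as n05-w2 g2's
`B8Prop7TowerAxialAdmissible.prop7RepairedC_famB8OfRecordSubBP_oneUp_admissible` (constant there `26384(θ.D+1)θ.L·530θ.D`; here `530·θ.D·θ.L²`): the previous
theorem at `e := Subtype.val`.  Inhabited: next theorem. [cite: Balaban1985RegularSpaces, Prop. 7 (1.144)–(1.145) p.100, (1.3)–(1.4) p.77] -/
theorem prop7RepairedC_famB8OfRecordSubBP_toAxialTower_domainSeq (hD : 2 ≤ θ.D) :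
    B8Ineq145.Prop7RepairedC (530 * (θ.D : ℝ) * (θ.L : ℝ) ^ 2)
      (fun j : {j : IdxB8SubB θ // B8ConstraintBonds.DomainSeq θ.L j.1.1.Ω} => famB8OfRecordSubBP θ β len j.1)
      (fun j => toAxialTowerResid θ β len j.1.1) :=
  prop7RepairedC_famB8OfRecordSubBP_toAxialTower_admissible β len hD
    (fun j : {j : IdxB8SubB θ // B8ConstraintBonds.DomainSeq θ.L j.1.1.Ω} => j.1) (fun j => j.2)

/-- **A6 — THE ADMISSIBLE SUB-FAMILY IS INHABITED AT EVERY `θ`**: n05-w2 g2's `B8Prop7TowerAxialAdmissible.exists_idxB8SubB_domainSeq_topCube` (print's nested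
tower `(T, □₁)`, depth `1`, `ρ = θ.L`, admissible by `cubeFam_domainSeq`) read as `Nonempty`; by name. [cite: Balaban1985RegularSpaces, (1.131) p.99, (1.3)–(1.4) p.77] -/
theorem nonempty_idxB8SubB_domainSeq (θ : Node00.Stage3Params) :
    Nonempty {j : IdxB8SubB θ // B8ConstraintBonds.DomainSeq θ.L j.1.1.Ω} := by
  obtain ⟨j, -, -, hj⟩ := exists_idxB8SubB_domainSeq_topCube θ (le_refl 1)
  exact ⟨⟨j, hj⟩⟩

#print axioms prop7RepairedC_famB8OfRecordSubBP_toAxialTower_admissible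
#print axioms prop7RepairedC_famB8OfRecordSubBP_toAxialTower_domainSeq
#print axioms nonempty_idxB8SubB_domainSeq

end Literature.MathematicalPhysics.QuantumFieldTheory.Balaban1983to89.B8Prop7TowerAxialRecordP

end
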